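/-
Copyright (c) 2026 the pub-hodgecm-mathlib formalisation cell (harness21).  Prover seat hodgecm-mathlib-K2Liu-p01 (g11) (K1a desk), Track B «K2-LIT» ∕ hLiu418 #184♮,
socket #41, KIND 1 a♮ — (K1a-OF-RECORD) ED. 3: THE K1-a♮ BLOCK OF RECORD AT `n = 2` WITH THE (dec) LETTER ASSEMBLED INSIDE by ★ p864440 `hdec_of_factorBounds_den`
(K1a desk WORD #12's common-denominator currency; K2E4-p10 (g10)'s ED. 3 recipe 2026-09-05T02:07:16Z) and the (supp½) letter by name (as ED. 2).
THEOREMS ONLY (no `def`, no `instance`, no notation, no named-fact hypothesis, no `sorry`).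
-/
import Summits.HodgeConjecture.HodgeConjecture.Theorems.K2LiuKindOneSingularTermOfRecordEdTwo    -- ★ p864235 ED. 2 (this seat) ⊇ ★ p864122 ED. 1, ★ p863404 §2, ★ p864052
import Summits.HodgeConjecture.HodgeConjecture.Theorems.K2LiuKindOneSingularDecayOfLettersDen     -- ★ p864440 (K2E4-p10): `hGb_of_countLetter_den`, `hdec_of_factorBounds_den`
import Summits.HodgeConjecture.HodgeConjecture.Theorems.K2LiuBigCellContinuationPointLetters      -- ★ `differentiableOn_re_pos_of_forall_isQRationalRegularAt`
import HarnessLib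

/-!
# Crux `HLiu418`, socket #41, KIND 1 a♮ — (K1a-OF-RECORD) ED. 3 `K2LiuKindOneSingularTermOfRecordEdThree`: THE K1-a♮ BLOCK OF RECORD, (dec) AND (supp½) ASSEMBLED INSIDE

Cell `hodgecm-mathlib`, crux item hLiu418 = `stmt-HodgeConjecture-24832` (helper lane `--supports … --as helper`, count-neutral), route of record
`HCCMUnconditional`; squad K2 ∕ K2Liu, road `K2_Liu`, socket #41 `sig_K2LiuSiegelEisensteinContinuation`, KIND 1, block K1-a♮ (★ ED. 20 :133–:147).

WHAT CHANGES FROM ED. 2 (★ p864235 `exists_kindOne_singularTerm_of_record₂`, (dec) in ★ p863404 §2's own currency `Na hdec`).  The (dec) letter is now ASSEMBLED INSIDE by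
★ p864440 `K2LiuKindOneSingularDecayOfLettersDen.hdec_of_factorBounds_den` in the K1a desk's ruled common-denominator currency (WORD #12 (1), 2026-09-05T01:20:29Z): of its
inputs, (L0) the constant `c = (∫β)⁻¹` and (L1) the tensor count `#univ = m` are DISCHARGED HERE (as ★ p864122), (L4-den) is ★ `hGb_of_countLetter_den hG` over the COUNT letter
`hPm` (= ★ p864306 `K2LiuKindOneSingularShellCount.pow_card_Pm_le_den`'s conclusion, by value), the (supp½) letter is ★ p864052 `hsupp_of_latticeLetters` ∘ ★ `hXW_of_tailLetters`
∘ ★ `hlatU_holds` (as ED. 2), and `hXhol` (the explicit expression is holomorphic on `{0 < re}`) is PROVED HERE by ★ p863404's `hEad` bookkeeping (★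
`differentiableOn_re_pos_of_forall_isQRationalRegularAt` on `hGn`, `hAc`, ★ `differentiableOn_finsetProd_inv_localScalarK1_mul hG`, `hP`).  BY VALUE remain exactly the named
letters in flight: «ARCH-CONT» `Ac hAc hA` ((Φ-S1) R90-C131-p02 (iii-b-3)), «LOC-FACE» `Gn hGn hW` (★ p864353 `locFace_letters_of_record`, by name at the tie modulo (Iw-S₀)),
the size `τa hτa` (free: `‖ι_∞ S‖`, `le_rfl`), (L2) `hAcb` ((L2-dock) K2Liu-p03 over C131-p02's ★ growth), (L3-den) `hGnb` (LH7-p05 `hGnb_of_placeBounds`), (L4-den) the count letter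
`Np Nd hCp hap hPm` (★ p864306, by name), (L5-den) `hPb` (★ p864404 `norm_prod_shell_le_den`, by name).
* **`exists_kindOne_singularTerm_of_record₃`** — ⊢ ★ p863404 §2's conclusion VERBATIM at `n = 2` (as ED. 1∕2: `c := (∫β)⁻¹`, `I := univ`, `HT := Σ_j A·∏W`,
  `P := Σ_{k≤mτ}(ε_v q_v^{1−2s})^k`, `T'' := ↑T₀`): the two WITNESS equations and the twelve K1-a♮ letters of ★ ED. 20 :133–:147.
[KudlaRallis1994, §2 (2.10)–(2.12)], [Tan1999, §3, §4 Prop. 4.8], [KudlaSweet1997, §1], [MoeglinWaldspurger1995, II.1.7, IV.1.9], [Shimura1997, §18.4 Prop. 18.14].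
HONEST LABEL.  Count-neutral helper, hypothesis-first in the in-flight letters; it closes no socket by itself: `HC_CM` is proved only modulo the 7 printed citations
(2 remaining named inputs: hLiu418 = `stmt-HodgeConjecture-24832`, h413 = `stmt-HodgeConjecture-24833`) until rung 0 closes.

## References
* [KudlaRallis1994] S. Kudla, S. Rallis, Ann. of Math. 140 (1994): §2 (2.10)–(2.12).   * [Tan1999] V. Tan, Canad. J. Math. 51 (1999): §3, §4 Prop. 4.8.
* [KudlaSweet1997] S. Kudla, W. J. Sweet, Israel J. Math. 98 (1997): §1.   * [MoeglinWaldspurger1995] C. Mœglin, J.-L. Waldspurger (1995): II.1.7, IV.1.9.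
* [Shimura1997] G. Shimura, CBMS 93 (1997): §18.4 Prop. 18.14.   * [BorelJacquet1979] A. Borel, H. Jacquet, Corvallis I (1979): §1.2, §4.1.
-/

set_option autoImplicit false
-- the mandated namespace repeats the single-problem summit's segment (`HodgeConjecture.HodgeConjecture`)
set_option linter.dupNamespace false

noncomputable section

open scoped Matrix ENNReal NNReal Topology ComplexConjugate
open NumberField IsDedekindDomain MeasureTheory MeasureTheory.Measure Filter Set Function Metric
open Literature.NumberTheory.Automorphic Literature.NumberTheory.Automorphic.UnitaryGroup Literature.NumberTheory.GaloisRepresentations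
open Literature.NumberTheory.LFunctions
open Literature.NumberTheory.GelbartRogawski1991 Literature.NumberTheory.GelbartRogawski1991.GRConstruction
open Literature.NumberTheory.GelbartRogawski1991.UnitaryDualPair
open Literature.NumberTheory.K2Lit.SiegelDoubled Literature.MeasureTheory.Group
open Literature.NumberTheory.Automorphic.IdeleClassGroup

namespace Summit.HodgeConjecture.HodgeConjecture.Cruxes.HLiu418.K2LiuKindOneSingularTermOfRecordEdThree

open K2LiuSiegelUnipotentFourierDefs K2LiuSiegelUnipotentCharacters K2LiuUnipotentCoveringWeight K2LiuSiegelFourierCoeffDelta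
open K2LiuQRationalDefs (IsQRationalRegularAt)
open K2LiuKindOneSingularTermPackage (exists_kindOne_singularTermPackage_of_placeLetters)
open K2LiuKindOneSingularSupportOfLetters (hsupp_of_latticeLetters hXW_of_tailLetters)
open K2LiuKindOneLineLatticeLocal (hlatU_holds)
open K2LiuKindOneSingularDecayOfLettersDen (hGb_of_countLetter_den hdec_of_factorBounds_den)
open K2LiuKindOneSingularScalarChangeOfSet (differentiableOn_finsetProd_inv_localScalarK1_mul)
open K2LiuBigCellContinuationPointLetters (differentiableOn_re_pos_of_forall_isQRationalRegularAt)

open Classical in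
/-- **(K1a-OF-RECORD) ED. 3 — THE K1-a♮ BLOCK OF RECORD AT `n = 2`, (dec) AND (supp½) ASSEMBLED INSIDE.**  Socket prefix at `n = 2` VERBATIM (as ★ p863630, no `wq hwq`).  BY VALUE,
in the tie's `obtain`ed currency: (i) the bad set `T₀` and the pole-cleared K1 scalar `G hG hsc` at `↑T₀` (★ p862613); (ii) ★ p863805's outputs `T D Pm mτ A W` with
`hPT hq hP htail`; (iii) the letters in flight — «ARCH-CONT» `Ac hAc hA`, «LOC-FACE» `Gn hGn hW` (★ p864353), the size `τa hτa`, and the GROWTH letters in the common-denominator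
currency: (L2) `hAcb`, (L3-den) `hGnb`, (L4-den) the COUNT letter `Np Nd hCp hap hPm` (★ p864306), (L5-den) `hPb` (★ p864404).  INSIDE: (L0) the constant, (L1) `#univ = m`,
(L4-den) ★ `hGb_of_countLetter_den hG`, (supp½) ★ `hsupp_of_latticeLetters … (★ hXW_of_tailLetters …) (★ hlatU_holds …)`, `hXhol` by ★ p863404's `hEad` bookkeeping, then
★ `hdec_of_factorBounds_den` and ★ p863404 §2.  THEN §2's conclusion VERBATIM at `n = 2` (`c := (∫β)⁻¹`, `I := univ`, `HT := Σ_j A·∏W`, `P := Σ_{k≤mτ S v}(ε_v q_v^{1−2s})^k`,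
`T'' := ↑T₀`): `∃ Eac` with the two WITNESS equations and the twelve K1-a♮ letters of ★ ED. 20 :133–:147.
[cite: KudlaRallis1994, §2 (2.10)–(2.12)] [cite: Tan1999, §3; §4 Prop. 4.8] [cite: KudlaSweet1997, §1] [cite: MoeglinWaldspurger1995, II.1.7, IV.1.9] [cite: Shimura1997, §18.4 Prop. 18.14] -/
theorem exists_kindOne_singularTerm_of_record₃
    (L : Type) [Field L] [NumberField L] [IsCMField L] (e : Fin 2 × Fin 1 ≃ Fin 2)
    (dV : Fin 2 → L) (hdV : ∀ i, IsCMField.complexConj L (dV i) = dV i) (hdV0 : ∀ i, dV i ≠ 0)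
    (dW : Fin 1 → L) (hdW : ∀ i, IsCMField.complexConj L (dW i) = dW i) (hdW0 : ∀ i, dW i ≠ 0)
    (lam : IdeleClassGroup L →ₜ* Circle) (hlam : IsConjugateSymplectic L lam) (hw : HasWeight L lam 1)
    (𝒦 : IwasawaDatum L e dV hdV dW hdW) (h𝒦 : 𝒦.IsStd) (f : ℂ → HA L e dV hdV dW hdW → ℂ)
    (hstd : IsStandardSectionFamily 𝒦 (toHeckeCharacter L lam⁻¹) f) (hcont : ∀ s, Continuous (f s))
    [MeasurableSpace (unipDelta L e dV hdV dW hdW)] [BorelSpace (unipDelta L e dV hdV dW hdW)]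
    (νN : Measure (unipDelta L e dV hdV dW hdW)) [νN.IsHaarMeasure]
    (β : unipDelta L e dV hdV dW hdW → ℝ≥0∞) (hβ : IsCoveringWeight (unipDeltaRat L e dV hdV dW hdW) β)
    (hβ0 : ∫⁻ u, β u ∂νN ≠ 0) (hβtop : ∫⁻ u, β u ∂νN ≠ ∞)
    {K : Set (unipDelta L e dV hdV dW hdW)} (hK : IsCompact K) (hβK : ∀ u, β u ≤ K.indicator 1 u)
    -- (i) the bad set of record and the pole-cleared K1 scalar of record at `↑T₀` (★ p862613 `exists_differentiableOn_sub_half_mul_scalarK1_cm`, obtained once in the tie)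
    (T₀ : Finset (HeightOneSpectrum (𝓞 (Fp L))))
    (G : ℂ → ℂ) (hG : DifferentiableOn ℂ G {s : ℂ | 0 < s.re})
    (hsc : ∀ s : ℂ, 1 / 2 < s.re →
      (s - 1 / 2) *
        (partialStandardL (T₀ : Set (HeightOneSpectrum (𝓞 (Fp L)))) (fun _ => {1}) (2 * s) /
          (partialStandardL (T₀ : Set (HeightOneSpectrum (𝓞 (Fp L)))) (fun _ => {1}) (2 * s + 1) *
            partialStandardL (T₀ : Set (HeightOneSpectrum (𝓞 (Fp L)))) (fun v => {(quadraticHeckeCharCM L).valueAtUniformizer v}) (2 * s + 2))) = G s)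
    -- (ii) ★ p863805's outputs of record (the tie's `obtain`ed names) with the four spec letters this block reads
    {m : ℕ}
    (T D Pm : skewMatrices ((IsCMField.complexConj L : L ≃ₐ[Fp L] L) : L →+* L) ((gramR L e dV hdV dW hdW).map (algebraMap (Fp L) L)) → HA L e dV hdV dW hdW →
      Finset (HeightOneSpectrum (𝓞 (Fp L))))
    (mτ : skewMatrices ((IsCMField.complexConj L : L ≃ₐ[Fp L] L) : L →+* L) ((gramR L e dV hdV dW hdW).map (algebraMap (Fp L) L)) → HeightOneSpectrum (𝓞 (Fp L)) → ℕ)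
    (A : skewMatrices ((IsCMField.complexConj L : L ≃ₐ[Fp L] L) : L →+* L) ((gramR L e dV hdV dW hdW).map (algebraMap (Fp L) L)) → Fin m → ℂ → HA L e dV hdV dW hdW → ℂ)
    (W : skewMatrices ((IsCMField.complexConj L : L ≃ₐ[Fp L] L) : L →+* L) ((gramR L e dV hdV dW hdW).map (algebraMap (Fp L) L)) → Fin m →
      HeightOneSpectrum (𝓞 (Fp L)) → ℂ → HA L e dV hdV dW hdW → ℂ)
    (hPT : ∀ S (h : HA L e dV hdV dW hdW), ∀ v ∈ Pm S h, v ∉ (T₀ : Set (HeightOneSpectrum (𝓞 (Fp L)))))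
    (hq : ∀ S (h : HA L e dV hdV dW hdW), ∀ v ∈ T S h, v.residueCard ≠ 0)
    (hP : ∀ S : skewMatrices ((IsCMField.complexConj L : L ≃ₐ[Fp L] L) : L →+* L) ((gramR L e dV hdV dW hdW).map (algebraMap (Fp L) L)),
      (S : Matrix (Fin 2) (Fin 2) L) ≠ 0 → (S : Matrix (Fin 2) (Fin 2) L).det = 0 → ∀ (h : HA L e dV hdV dW hdW), ∀ v ∈ D S h,
        DifferentiableOn ℂ (fun s : ℂ => ∑ k ∈ Finset.range (mτ S v + 1), ((quadraticHeckeCharCM L).valueAtUniformizer v * (v.residueCard : ℂ) ^ (1 - 2 * s)) ^ k)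
          {s : ℂ | 0 < s.re})
    (htail : ∀ S : skewMatrices ((IsCMField.complexConj L : L ≃ₐ[Fp L] L) : L →+* L) ((gramR L e dV hdV dW hdW).map (algebraMap (Fp L) L)),
      (S : Matrix (Fin 2) (Fin 2) L) ≠ 0 → (S : Matrix (Fin 2) (Fin 2) L).det = 0 → ∀ (s : ℂ) (h : HA L e dV hdV dW hdW), 1 < s.re →
        (((∫⁻ u, β u ∂νN).toReal⁻¹ : ℝ) : ℝ) • whittakerDelta L e dV hdV dW hdW νN (S : Matrix (Fin 2) (Fin 2) L) (f s) h =
          (((∫⁻ u, β u ∂νN).toReal⁻¹ : ℝ) : ℂ) * (∑ j, A S j s h * ∏ v ∈ T S h, W S j v s h) *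
            (partialStandardL ((T₀ : Set (HeightOneSpectrum (𝓞 (Fp L)))) ∪ (Pm S h : Set (HeightOneSpectrum (𝓞 (Fp L))))) (fun _ => {1}) (2 * s) /
              (partialStandardL ((T₀ : Set (HeightOneSpectrum (𝓞 (Fp L)))) ∪ (Pm S h : Set (HeightOneSpectrum (𝓞 (Fp L))))) (fun _ => {1}) (2 * s + 1) *
                partialStandardL ((T₀ : Set (HeightOneSpectrum (𝓞 (Fp L)))) ∪ (Pm S h : Set (HeightOneSpectrum (𝓞 (Fp L)))))
                  (fun v => {(quadraticHeckeCharCM L).valueAtUniformizer v}) (2 * s + 2))) *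
            ∏ v ∈ D S h, ∑ k ∈ Finset.range (mτ S v + 1), ((quadraticHeckeCharCM L).valueAtUniformizer v * (v.residueCard : ℂ) ^ (1 - 2 * s)) ^ k)
    -- (iii) THE LETTERS IN FLIGHT.  «ARCH-CONT»: the archimedean factors continue holomorphically to `{0 < re}` ((Φ-S1) R90-C131-p02)
    (Ac : skewMatrices ((IsCMField.complexConj L : L ≃ₐ[Fp L] L) : L →+* L) ((gramR L e dV hdV dW hdW).map (algebraMap (Fp L) L)) → Fin m → ℂ → HA L e dV hdV dW hdW → ℂ)
    (hAc : ∀ S : skewMatrices ((IsCMField.complexConj L : L ≃ₐ[Fp L] L) : L →+* L) ((gramR L e dV hdV dW hdW).map (algebraMap (Fp L) L)),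
      (S : Matrix (Fin 2) (Fin 2) L) ≠ 0 → (S : Matrix (Fin 2) (Fin 2) L).det = 0 → ∀ (h : HA L e dV hdV dW hdW) (i : Fin m),
        DifferentiableOn ℂ (fun s => Ac S i s h) {s : ℂ | 0 < s.re})
    (hA : ∀ S : skewMatrices ((IsCMField.complexConj L : L ≃ₐ[Fp L] L) : L →+* L) ((gramR L e dV hdV dW hdW).map (algebraMap (Fp L) L)),
      (S : Matrix (Fin 2) (Fin 2) L) ≠ 0 → (S : Matrix (Fin 2) (Fin 2) L).det = 0 → ∀ (h : HA L e dV hdV dW hdW) (i : Fin m) (s : ℂ), 1 < s.re → A S i s h = Ac S i s h)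
    -- «LOC-FACE»: the local factors continue to `q_v`-rational functions regular at every `s₀ ∈ {0 < re}` (LH4-p07 over ★ `exists_localFace_kindOneSingular`)
    (Gn : skewMatrices ((IsCMField.complexConj L : L ≃ₐ[Fp L] L) : L →+* L) ((gramR L e dV hdV dW hdW).map (algebraMap (Fp L) L)) → Fin m →
      HeightOneSpectrum (𝓞 (Fp L)) → ℂ → HA L e dV hdV dW hdW → ℂ)
    (hGn : ∀ S : skewMatrices ((IsCMField.complexConj L : L ≃ₐ[Fp L] L) : L →+* L) ((gramR L e dV hdV dW hdW).map (algebraMap (Fp L) L)),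
      (S : Matrix (Fin 2) (Fin 2) L) ≠ 0 → (S : Matrix (Fin 2) (Fin 2) L).det = 0 → ∀ (h : HA L e dV hdV dW hdW) (i : Fin m), ∀ v ∈ T S h,
        ∀ s₀ : ℂ, 0 < s₀.re → IsQRationalRegularAt (v.residueCard) s₀ (fun s => Gn S i v s h))
    (hW : ∀ S : skewMatrices ((IsCMField.complexConj L : L ≃ₐ[Fp L] L) : L →+* L) ((gramR L e dV hdV dW hdW).map (algebraMap (Fp L) L)),
      (S : Matrix (Fin 2) (Fin 2) L) ≠ 0 → (S : Matrix (Fin 2) (Fin 2) L).det = 0 → ∀ (h : HA L e dV hdV dW hdW) (i : Fin m), ∀ v ∈ T S h,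
        ∀ s : ℂ, 1 < s.re → W S i v s h = Gn S i v s h)
    -- the size, and the GROWTH letters in the ruled common-denominator currency (★ p864440 `hdec_of_factorBounds_den`'s by-value inputs): (L2) the Gaussian letter of `Ac`
    -- ((Φ-S1) C131-p02 ∕ (L2-dock) K2Liu-p03), (L3-den) the finite head (LH7-p05), (L4-den) the COUNT letter of the moving set (★ p864306's conclusion), (L5-den) the shells
    -- (★ p864404's conclusion)
    (τa : skewMatrices ((IsCMField.complexConj L : L ≃ₐ[Fp L] L) : L →+* L) ((gramR L e dV hdV dW hdW).map (algebraMap (Fp L) L)) → ℝ)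
    (hτa : ∀ S : skewMatrices ((IsCMField.complexConj L : L ≃ₐ[Fp L] L) : L →+* L) ((gramR L e dV hdV dW hdW).map (algebraMap (Fp L) L)),
      ‖(fun i j => NumberField.mixedEmbedding L ((S : Matrix (Fin 2) (Fin 2) L) i j))‖ ≤ τa S)
    (hAcb : ∀ z : ℂ, 0 < z.re → ∃ (N₁ : ℕ) (C a b a' r : ℝ), 0 ≤ C ∧ 0 ≤ a ∧ 0 < b ∧ 0 ≤ a' ∧ 0 < r ∧
      ∀ (S : skewMatrices ((IsCMField.complexConj L : L ≃ₐ[Fp L] L) : L →+* L) ((gramR L e dV hdV dW hdW).map (algebraMap (Fp L) L))) (s : ℂ), dist s z < r →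
      ∀ h : HA L e dV hdV dW hdW, (S : Matrix (Fin 2) (Fin 2) L) ≠ 0 → (S : Matrix (Fin 2) (Fin 2) L).det = 0 → ∀ i : Fin m,
      ‖Ac S i s h‖ ≤ C * adelicHeightGL (2 + 2) L (h : GL (Fin (2 + 2)) (AdeleRing (𝓞 L) L)) ^ a *
        (Real.exp (-(b * adelicHeightGL (2 + 2) L (h : GL (Fin (2 + 2)) (AdeleRing (𝓞 L) L)) ^ (-a') * τa S)) * (1 + τa S) ^ N₁))
    (hGnb : ∀ z : ℂ, 0 < z.re → ∃ (N₂ Nd₂ : ℕ) (C a r : ℝ), 0 ≤ C ∧ 0 ≤ a ∧ 0 < r ∧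
      ∀ (S : skewMatrices ((IsCMField.complexConj L : L ≃ₐ[Fp L] L) : L →+* L) ((gramR L e dV hdV dW hdW).map (algebraMap (Fp L) L))) (s : ℂ), dist s z < r →
      ∀ h : HA L e dV hdV dW hdW, (S : Matrix (Fin 2) (Fin 2) L) ≠ 0 → (S : Matrix (Fin 2) (Fin 2) L).det = 0 →
      ∀ d : ℕ, 1 ≤ d → (∀ i j, IsIntegral ℤ ((d : L) * (S : Matrix (Fin 2) (Fin 2) L) i j)) → ∀ i : Fin m,
      ‖∏ v ∈ T S h, Gn S i v s h‖ ≤ C * adelicHeightGL (2 + 2) L (h : GL (Fin (2 + 2)) (AdeleRing (𝓞 L) L)) ^ a * (1 + τa S) ^ N₂ * (d : ℝ) ^ Nd₂)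
    (Np Nd : ℕ) {Cp ap : ℝ} (hCp : 0 ≤ Cp) (hap : 0 ≤ ap)
    (hPm : ∀ (S : skewMatrices ((IsCMField.complexConj L : L ≃ₐ[Fp L] L) : L →+* L) ((gramR L e dV hdV dW hdW).map (algebraMap (Fp L) L))) (h : HA L e dV hdV dW hdW),
      (S : Matrix (Fin 2) (Fin 2) L) ≠ 0 → (S : Matrix (Fin 2) (Fin 2) L).det = 0 →
      ∀ d : ℕ, 1 ≤ d → (∀ i j, IsIntegral ℤ ((d : L) * (S : Matrix (Fin 2) (Fin 2) L) i j)) →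
      (16 / 3 : ℝ) ^ (Pm S h).card ≤ Cp * adelicHeightGL (2 + 2) L (h : GL (Fin (2 + 2)) (AdeleRing (𝓞 L) L)) ^ ap * (1 + τa S) ^ Np * (d : ℝ) ^ Nd)
    (hPb : ∀ z : ℂ, 0 < z.re → ∃ (N₄ Nd₄ : ℕ) (C a r : ℝ), 0 ≤ C ∧ 0 ≤ a ∧ 0 < r ∧
      ∀ (S : skewMatrices ((IsCMField.complexConj L : L ≃ₐ[Fp L] L) : L →+* L) ((gramR L e dV hdV dW hdW).map (algebraMap (Fp L) L))) (s : ℂ), dist s z < r →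
      ∀ h : HA L e dV hdV dW hdW, (S : Matrix (Fin 2) (Fin 2) L) ≠ 0 → (S : Matrix (Fin 2) (Fin 2) L).det = 0 →
      ∀ d : ℕ, 1 ≤ d → (∀ i j, IsIntegral ℤ ((d : L) * (S : Matrix (Fin 2) (Fin 2) L) i j)) →
      ‖∏ v ∈ D S h, ∑ k ∈ Finset.range (mτ S v + 1), ((quadraticHeckeCharCM L).valueAtUniformizer v * (v.residueCard : ℂ) ^ (1 - 2 * s)) ^ k‖ ≤
        C * adelicHeightGL (2 + 2) L (h : GL (Fin (2 + 2)) (AdeleRing (𝓞 L) L)) ^ a * (1 + τa S) ^ N₄ * (d : ℝ) ^ Nd₄) :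
    ∃ (Eac : skewMatrices ((IsCMField.complexConj L : L ≃ₐ[Fp L] L) : L →+* L) ((gramR L e dV hdV dW hdW).map (algebraMap (Fp L) L)) → ℂ → HA L e dV hdV dW hdW → ℂ),
      -- the WITNESS equations ((F-V) transparency; BLOCK D's row D-1 reads `hwit`)
      (∀ (S : skewMatrices ((IsCMField.complexConj L : L ≃ₐ[Fp L] L) : L →+* L) ((gramR L e dV hdV dW hdW).map (algebraMap (Fp L) L))) (s : ℂ) (h : HA L e dV hdV dW hdW),
        (S : Matrix (Fin 2) (Fin 2) L) ≠ 0 → (S : Matrix (Fin 2) (Fin 2) L).det = 0 →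
          Eac S s h = (((∫⁻ u, β u ∂νN).toReal⁻¹ : ℝ) : ℂ) * (∑ i, Ac S i s h * ∏ v ∈ T S h, Gn S i v s h) *
            ((∏ v ∈ Pm S h, ((1 - (v.residueCard : ℂ) ^ (-(2 * s))) / ((1 - (v.residueCard : ℂ) ^ (-(2 * s + 1))) * (1 - (quadraticHeckeCharCM L).valueAtUniformizer v * (v.residueCard : ℂ) ^ (-(2 * s + 2)))))) * G s) *
            ∏ v ∈ D S h, ∑ k ∈ Finset.range (mτ S v + 1), ((quadraticHeckeCharCM L).valueAtUniformizer v * (v.residueCard : ℂ) ^ (1 - 2 * s)) ^ k) ∧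
      (∀ (S : skewMatrices ((IsCMField.complexConj L : L ≃ₐ[Fp L] L) : L →+* L) ((gramR L e dV hdV dW hdW).map (algebraMap (Fp L) L))) (s : ℂ) (h : HA L e dV hdV dW hdW),
        ¬ ((S : Matrix (Fin 2) (Fin 2) L) ≠ 0 ∧ (S : Matrix (Fin 2) (Fin 2) L).det = 0) → Eac S s h = 0) ∧
      -- the twelve K1-a♮ letters of ★ ED. 20 :133–:147, token for token at `n = 2`
      (∀ S x, DifferentiableOn ℂ (fun s => Eac S s x) {s : ℂ | 0 < s.re}) ∧
      (∀ S : skewMatrices ((IsCMField.complexConj L : L ≃ₐ[Fp L] L) : L →+* L) ((gramR L e dV hdV dW hdW).map (algebraMap (Fp L) L)),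
        (S : Matrix (Fin 2) (Fin 2) L) ≠ 0 → (S : Matrix (Fin 2) (Fin 2) L).det = 0 → ∀ (s : ℂ) (h : HA L e dV hdV dW hdW), ((2 : ℕ) : ℝ) / 2 < s.re →
          (s - 1 / 2) * (((∫⁻ u, β u ∂νN).toReal⁻¹ : ℝ) • whittakerDelta L e dV hdV dW hdW νN (S : Matrix (Fin 2) (Fin 2) L) (f s) h) = Eac S s h) ∧
      ∃ (τa : skewMatrices ((IsCMField.complexConj L : L ≃ₐ[Fp L] L) : L →+* L) ((gramR L e dV hdV dW hdW).map (algebraMap (Fp L) L)) → ℝ),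
        (∀ S : skewMatrices ((IsCMField.complexConj L : L ≃ₐ[Fp L] L) : L →+* L) ((gramR L e dV hdV dW hdW).map (algebraMap (Fp L) L)),
          ‖(fun i j => NumberField.mixedEmbedding L ((S : Matrix (Fin 2) (Fin 2) L) i j))‖ ≤ τa S) ∧
        ∃ Na : ℕ,
          (∀ z : ℂ, 0 < z.re → ∃ C a c a' r : ℝ, 0 ≤ C ∧ 0 ≤ a ∧ 0 < c ∧ 0 ≤ a' ∧ 0 < r ∧ ∀ S (s : ℂ), dist s z < r → ∀ h : HA L e dV hdV dW hdW,
            ‖Eac S s h‖ ≤ C * adelicHeightGL (2 + 2) L (h : GL (Fin (2 + 2)) (AdeleRing (𝓞 L) L)) ^ a *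
              (Real.exp (-(c * adelicHeightGL (2 + 2) L (h : GL (Fin (2 + 2)) (AdeleRing (𝓞 L) L)) ^ (-a') * τa S)) * (1 + τa S) ^ Na)) ∧
          ∃ Ca κa : ℝ, 0 < Ca ∧ 0 ≤ κa ∧
            (∀ S (s : ℂ) (h : HA L e dV hdV dW hdW), 0 < s.re → Eac S s h ≠ 0 →
              ∃ D : ℕ, 1 ≤ D ∧ (D : ℝ) ≤ Ca * adelicHeightGL (2 + 2) L (h : GL (Fin (2 + 2)) (AdeleRing (𝓞 L) L)) ^ κa ∧
                ∀ i j, IsIntegral ℤ ((D : L) * (S : Matrix (Fin 2) (Fin 2) L) i j)) := by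
  -- `ε_{L∕L⁺}` is unitary (finite order): the hypothesis of ★ p863157's transported-scalar holomorphy
  have hε : (quadraticHeckeCharCM L).IsUnitary := (Literature.RepresentationTheory.HarrisKudlaSweet1996.isFiniteOrder_quadraticHeckeCharCM (L := L)).isUnitary
  -- (L0) the constant `c S h := (∫β)⁻¹`: `‖(c₀ : ℂ)‖ ≤ ‖(c₀ : ℂ)‖ · H^0 · (1 + τa S)^0`
  have hcb : ∀ (S : skewMatrices ((IsCMField.complexConj L : L ≃ₐ[Fp L] L) : L →+* L) ((gramR L e dV hdV dW hdW).map (algebraMap (Fp L) L))) (h : HA L e dV hdV dW hdW),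
      (S : Matrix (Fin 2) (Fin 2) L) ≠ 0 → (S : Matrix (Fin 2) (Fin 2) L).det = 0 →
      ‖(fun (_ : skewMatrices ((IsCMField.complexConj L : L ≃ₐ[Fp L] L) : L →+* L) ((gramR L e dV hdV dW hdW).map (algebraMap (Fp L) L))) (_ : HA L e dV hdV dW hdW) => ((((∫⁻ u, β u ∂νN).toReal⁻¹ : ℝ) : ℂ))) S h‖ ≤
        ‖((((∫⁻ u, β u ∂νN).toReal⁻¹ : ℝ) : ℂ))‖ * adelicHeightGL (2 + 2) L (h : GL (Fin (2 + 2)) (AdeleRing (𝓞 L) L)) ^ (0 : ℝ) * (1 + τa S) ^ 0 := by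
    intro S h _ _
    rw [Real.rpow_zero, pow_zero, mul_one, mul_one]
  -- (L1) the tensor count `#univ = m`
  have hI : ∀ (S : skewMatrices ((IsCMField.complexConj L : L ≃ₐ[Fp L] L) : L →+* L) ((gramR L e dV hdV dW hdW).map (algebraMap (Fp L) L))) (h : HA L e dV hdV dW hdW),
      ((fun (_ : skewMatrices ((IsCMField.complexConj L : L ≃ₐ[Fp L] L) : L →+* L) ((gramR L e dV hdV dW hdW).map (algebraMap (Fp L) L))) (_ : HA L e dV hdV dW hdW) => (Finset.univ : Finset (Fin m))) S h).card ≤ m := fun _ _ => by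
    simp only [Finset.card_univ, Fintype.card_fin, le_refl]
  -- (L4-den) ★ p864440 §1 from the count letter and the continuity of `G`
  have hGb := hGb_of_countLetter_den L e dV hdV dW hdW G hG Pm τa Np Nd hCp hap hPm
  -- (supp½) BY NAME: ★ p864052 from the half-plane link (§2's own identity letters) and the lattice letters for every open level (★ p863909)
  obtain ⟨Ca, κa, hCa, hκa, hsupp⟩ := hsupp_of_latticeLetters L e dV hdV dW hdW 𝒦 h𝒦 f hstd hcont νN
    (fun _ _ => ((((∫⁻ u, β u ∂νN).toReal⁻¹ : ℝ) : ℂ))) (fun _ _ => (Finset.univ : Finset (Fin m))) T Ac Gn Pm G D (fun S _ v s => ∑ k ∈ Finset.range (mτ S v + 1), ((quadraticHeckeCharCM L).valueAtUniformizer v * (v.residueCard : ℂ) ^ (1 - 2 * s)) ^ k)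
    (hXW_of_tailLetters L e dV hdV dW hdW f νN β (T₀ : Set (HeightOneSpectrum (𝓞 (Fp L)))) G hsc
      (fun _ _ => ((((∫⁻ u, β u ∂νN).toReal⁻¹ : ℝ) : ℂ))) D (fun S _ v s => ∑ k ∈ Finset.range (mτ S v + 1), ((quadraticHeckeCharCM L).valueAtUniformizer v * (v.residueCard : ℂ) ^ (1 - 2 * s)) ^ k)
      Pm hPT (fun S s h => ∑ j, A S j s h * ∏ v ∈ T S h, W S j v s h) htail
      (fun _ _ => (Finset.univ : Finset (Fin m))) T A W (fun _ _ _ _ _ _ => rfl)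
      Ac (fun S hS0 hSd h i _ s hs => hA S hS0 hSd h i s hs) Gn (fun S hS0 hSd h i _ v hv s hs => hW S hS0 hSd h i v hv s hs))
    (hlatU_holds L e dV hdV dW hdW hdV0 hdW0)
  -- `hXhol`: the explicit expression is holomorphic on `{0 < re}` at rank-one `S` (★ p863404's `hEad` bookkeeping)
  have hXhol : ∀ (S : skewMatrices ((IsCMField.complexConj L : L ≃ₐ[Fp L] L) : L →+* L) ((gramR L e dV hdV dW hdW).map (algebraMap (Fp L) L))) (h : HA L e dV hdV dW hdW), (S : Matrix (Fin 2) (Fin 2) L) ≠ 0 → (S : Matrix (Fin 2) (Fin 2) L).det = 0 →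
      DifferentiableOn ℂ (fun s : ℂ => (fun (_ : skewMatrices ((IsCMField.complexConj L : L ≃ₐ[Fp L] L) : L →+* L) ((gramR L e dV hdV dW hdW).map (algebraMap (Fp L) L))) (_ : HA L e dV hdV dW hdW) => ((((∫⁻ u, β u ∂νN).toReal⁻¹ : ℝ) : ℂ))) S h *
        (∑ i ∈ (fun (_ : skewMatrices ((IsCMField.complexConj L : L ≃ₐ[Fp L] L) : L →+* L) ((gramR L e dV hdV dW hdW).map (algebraMap (Fp L) L))) (_ : HA L e dV hdV dW hdW) => (Finset.univ : Finset (Fin m))) S h, Ac S i s h * ∏ v ∈ T S h, Gn S i v s h) *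
        ((∏ v ∈ Pm S h, ((1 - (v.residueCard : ℂ) ^ (-(2 * s))) / ((1 - (v.residueCard : ℂ) ^ (-(2 * s + 1))) * (1 - (quadraticHeckeCharCM L).valueAtUniformizer v * (v.residueCard : ℂ) ^ (-(2 * s + 2)))))) * G s) *
        ∏ v ∈ D S h, (fun S _ v s => ∑ k ∈ Finset.range (mτ S v + 1), ((quadraticHeckeCharCM L).valueAtUniformizer v * (v.residueCard : ℂ) ^ (1 - 2 * s)) ^ k) S h v s) {s : ℂ | 0 < s.re} := by
    intro S x hS0 hSd
    have hF : DifferentiableOn ℂ (fun s => ∑ i ∈ (Finset.univ : Finset (Fin m)), Ac S i s x * ∏ v ∈ T S x, Gn S i v s x) {s : ℂ | 0 < s.re} :=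
      DifferentiableOn.fun_sum fun i _ => (hAc S hS0 hSd x i).mul (DifferentiableOn.fun_finsetProd fun v hv =>
        differentiableOn_re_pos_of_forall_isQRationalRegularAt (hq S x v hv) fun s₀ hs₀ => hGn S hS0 hSd x i v hv s₀ hs₀)
    have hSG : DifferentiableOn ℂ (fun s : ℂ => (∏ v ∈ Pm S x, ((1 - (v.residueCard : ℂ) ^ (-(2 * s))) / ((1 - (v.residueCard : ℂ) ^ (-(2 * s + 1))) * (1 - (quadraticHeckeCharCM L).valueAtUniformizer v * (v.residueCard : ℂ) ^ (-(2 * s + 2)))))) * G s) {s : ℂ | 0 < s.re} :=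
      differentiableOn_finsetProd_inv_localScalarK1_mul hε (Pm S x) hG
    exact (((differentiableOn_const _).mul hF).mul hSG).mul (DifferentiableOn.fun_finsetProd (hP S hS0 hSd x))
  -- (dec) ★ p864440 §2 in the common-denominator currency
  obtain ⟨Na, hdec⟩ := hdec_of_factorBounds_den L e dV hdV dW hdW G
    (fun _ _ => ((((∫⁻ u, β u ∂νN).toReal⁻¹ : ℝ) : ℂ))) D (fun S _ v s => ∑ k ∈ Finset.range (mτ S v + 1), ((quadraticHeckeCharCM L).valueAtUniformizer v * (v.residueCard : ℂ) ^ (1 - 2 * s)) ^ k)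
    Pm (fun _ _ => (Finset.univ : Finset (Fin m))) T Ac Gn τa hτa 0 (norm_nonneg _) le_rfl hcb m hI
    (fun z hz => by
      obtain ⟨N₁, C, a, b, a', r, hC, ha, hb, ha', hr, hbd⟩ := hAcb z hz
      exact ⟨N₁, C, a, b, a', r, hC, ha, hb, ha', hr, fun S s hs h hS0 hSd i _ => hbd S s hs h hS0 hSd i⟩)
    (fun z hz => by
      obtain ⟨N₂, Nd₂, C, a, r, hC, ha, hr, hbd⟩ := hGnb z hz
      exact ⟨N₂, Nd₂, C, a, r, hC, ha, hr, fun S s hs h hS0 hSd d hd hint i _ => hbd S s hs h hS0 hSd d hd hint i⟩)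
    hGb hPb hCa hκa hsupp hXhol
  -- ★ p863404 §2 at the letters of record
  exact exists_kindOne_singularTermPackage_of_placeLetters L e dV hdV hdV0 dW hdW hdW0 lam hlam hw 𝒦 h𝒦 f hstd hcont νN β hβ hβ0 hβtop hK hβK
    (T₀ : Set (HeightOneSpectrum (𝓞 (Fp L)))) G hG hsc
    (fun _ _ => ((((∫⁻ u, β u ∂νN).toReal⁻¹ : ℝ) : ℂ))) D (fun S _ v s => ∑ k ∈ Finset.range (mτ S v + 1), ((quadraticHeckeCharCM L).valueAtUniformizer v * (v.residueCard : ℂ) ^ (1 - 2 * s)) ^ k)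
    hP Pm hPT (fun S s h => ∑ j, A S j s h * ∏ v ∈ T S h, W S j v s h) htail
    (fun _ _ => (Finset.univ : Finset (Fin m))) T (fun v => v.residueCard) hq A W (fun _ _ _ _ _ _ => rfl)
    Ac (fun S hS0 hSd h i _ => hAc S hS0 hSd h i) (fun S hS0 hSd h i _ s hs => hA S hS0 hSd h i s hs)
    Gn (fun S hS0 hSd h i _ v hv s₀ hs₀ => hGn S hS0 hSd h i v hv s₀ hs₀) (fun S hS0 hSd h i _ v hv s hs => hW S hS0 hSd h i v hv s hs)
    τa hτa Na hdec hCa hκa hsupp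

end Summit.HodgeConjecture.HodgeConjecture.Cruxes.HLiu418.K2LiuKindOneSingularTermOfRecordEdThree

end
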